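import Summits.CriticalPhenomena.PercolationContinuityZ3.Theorems.PercNearOneGluingNoHeavyLowerTailQuantitativeS5PatternTransfer
import HarnessLib

/-!
# PATTERN TRANSFER with its explicit FLOOR: `μ(v ↮ T)·μ(P^o_a ∩ {o ↮ v})`

Support file (`--supports stmt-CriticalPhenomena-4575`), prover seat `prim-rate-mine-2` (lane prim-rate, constants-miner (c), BENCH rows
M2-R32 / M2-R33; `run/shared/lean/prim/prim-rate/prim-rate-mine-2/PROOFS.md` §P31–§P32).  No definitions, no named facts, no sorries;
standard axioms.

Refinement of `CSH.pattern_transfer` (row M2-R32): the part of the pattern `P^o_a` on which `o ↮ v` is pure slack.  For ANY weights, ANY rank,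
`v ∉ T`:

* `CSH.pattern_transfer_floor` — **`μ({v ↮ T} ∩ {o ↔ v})·μ(P^v_a) + μ(v ↮ T)·μ(P^o_a ∩ {o ↮ v}) ≤ μ(v ↮ T)·μ(P^o_a)`**;
* `CSH.pattern_transfer_strict_of_pos` — hence the transfer is STRICT as soon as `μ(v ↮ T) > 0` and `μ(P^o_a ∩ {o ↮ v}) > 0`, i.e. (on a
  support graph) as soon as `a` is reachable from `o` avoiding `T_{<a} ∪ {v}` — the positive half of the equality locus of row M2-R33.

Proof: `P^o_a ∩ {o ↔ v} = P^v_a ∩ {o ↔ v}` (same cluster), so `μ(P^o_a) = μ(P^o_a ∩ {o ↮ v}) + μ(P^v_a ∩ {o ↔ v})`, and the chain of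
row M2-R32 (vdBHK Thm 1.3 twice given `{v ↮ T_{<a}}`) bounds `μ(v ↮ T, o ↔ v)·μ(P^v_a) ≤ μ(v ↮ T)·μ(P^v_a ∩ {o ↔ v})`.
[cite: VandenbergHaggstromKahn2005, Thm. 1.3 (p. 6)] [cite: KozmaNitzan2024, Conj. 4 (p. 32)]
-/

noncomputable section

namespace Summit.CriticalPhenomena.PercolationContinuityZ3.Theorems

open MeasureTheory Set Literature.Probability.LatticeModels Literature.Probability.Percolation
open scoped Classical

namespace CSH

universe u

variable {V : Type u} [Fintype V]

/-- **PATTERN TRANSFER WITH ITS FLOOR.**  Any weights `w`, any relay set `T` and rank `r`, any `a`, observers `o` and `v ∉ T`: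
`μ({v ↮ T} ∩ {o ↔ v})·μ(P^v_a) + μ(v ↮ T)·μ(P^o_a ∩ {o ↮ v}) ≤ μ(v ↮ T)·μ(P^o_a)`, `P^u_a = {u ↔ a} ∩ ⋂_{t ∈ T, r t < r a} {u ↮ t}`.
[cite: VandenbergHaggstromKahn2005, Thm. 1.3 (p. 6)] [cite: KozmaNitzan2024, Conj. 4 (p. 32)] -/
theorem pattern_transfer_floor (w : Sym2 V → unitInterval) (T : Finset V) (r : V → ℕ) (a o v : V) (hvT : v ∉ T) :
    (prodBernoulli w).real ({ω : BondConfig V | ∀ t ∈ T, ¬ (openGraph ω).Reachable v t} ∩ openConn o v) *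
          (prodBernoulli w).real (openConn v a ∩ ⋂ t ∈ T.filter (fun t => r t < r a), (openConn v t)ᶜ : Set (BondConfig V)) +
        (prodBernoulli w).real {ω : BondConfig V | ∀ t ∈ T, ¬ (openGraph ω).Reachable v t} *
          (prodBernoulli w).real ((openConn o a ∩ ⋂ t ∈ T.filter (fun t => r t < r a), (openConn o t)ᶜ : Set (BondConfig V)) ∩
            (openConn o v)ᶜ) ≤
      (prodBernoulli w).real {ω : BondConfig V | ∀ t ∈ T, ¬ (openGraph ω).Reachable v t} *
        (prodBernoulli w).real (openConn o a ∩ ⋂ t ∈ T.filter (fun t => r t < r a), (openConn o t)ᶜ : Set (BondConfig V)) := by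
  set μ := prodBernoulli w with hμ
  -- the lower relays `X = T_{<a}` and the conditioning event `D = {v ↮ X}`; the upper relays and their avoidance event
  set X : Set V := {t | t ∈ T ∧ r t < r a} with hX
  set D : Set (BondConfig V) := {ω : BondConfig V | ∀ x ∈ X, ¬ (openGraph ω).Reachable v x} with hD
  set Sav : Set (BondConfig V) := {ω : BondConfig V | ∀ t ∈ T, r a ≤ r t → ¬ (openGraph ω).Reachable v t} with hSav
  set Ovo : Set (BondConfig V) := openConn v o with hOvo
  set Ova : Set (BondConfig V) := openConn v a with hOva
  have hvX : v ∉ X := fun h => hvT h.1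
  have hn : ∀ S : Set (BondConfig V), 0 ≤ μ.real S := fun _ => measureReal_nonneg
  -- set identities
  have hT : {ω : BondConfig V | ∀ t ∈ T, ¬ (openGraph ω).Reachable v t} = D ∩ Sav := by
    ext ω
    simp only [hD, hSav, hX, mem_inter_iff, mem_setOf_eq]
    constructor
    · intro h
      exact ⟨fun x hx => h x hx.1, fun t ht _ => h t ht⟩
    · rintro ⟨h1, h2⟩ t ht
      rcases lt_or_ge (r t) (r a) with hlt | hge
      · exact h1 t ⟨ht, hlt⟩
      · exact h2 t ht hge
  have hOov : (openConn o v : Set (BondConfig V)) = Ovo := by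
    ext ω
    exact ⟨fun h => SimpleGraph.Reachable.symm h, fun h => SimpleGraph.Reachable.symm h⟩
  have hPv : (openConn v a ∩ ⋂ t ∈ T.filter (fun t => r t < r a), (openConn v t)ᶜ : Set (BondConfig V)) = D ∩ Ova := by
    ext ω
    simp only [hD, hX, hOva, mem_inter_iff, mem_iInter, mem_compl_iff, Finset.mem_filter, mem_setOf_eq, openConn]
    constructor
    · rintro ⟨h1, h2⟩
      exact ⟨fun x hx => h2 x ⟨hx.1, hx.2⟩, h1⟩
    · rintro ⟨h1, h2⟩
      exact ⟨h2, fun x hx => h1 x ⟨hx.1, hx.2⟩⟩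
  have hmeas : ∀ S : Set (BondConfig V), MeasurableSet S := fun _ => MeasurableSet.of_discrete
  -- `P^o_a ∩ {o ↔ v} = P^v_a ∩ {o ↔ v}`: the pattern splits as `μ(P^o_a) = μ(P^o_a ∩ {o ↮ v}) + μ(D ∩ Ova ∩ Ovo)`
  have hsplit : μ.real (openConn o a ∩ ⋂ t ∈ T.filter (fun t => r t < r a), (openConn o t)ᶜ : Set (BondConfig V)) =
      μ.real ((openConn o a ∩ ⋂ t ∈ T.filter (fun t => r t < r a), (openConn o t)ᶜ : Set (BondConfig V)) ∩ Ovoᶜ) +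
        μ.real (D ∩ Ova ∩ Ovo) := by
    have hcap : (openConn o a ∩ ⋂ t ∈ T.filter (fun t => r t < r a), (openConn o t)ᶜ : Set (BondConfig V)) ∩ Ovo =
        D ∩ Ova ∩ Ovo := by
      ext ω
      simp only [hD, hX, hOva, hOvo, mem_inter_iff, mem_iInter, mem_compl_iff, Finset.mem_filter, mem_setOf_eq, openConn]
      constructor
      · rintro ⟨⟨h1, h2⟩, h3⟩
        exact ⟨⟨fun x hx hvx => h2 x ⟨hx.1, hx.2⟩ (h3.symm.trans hvx), h3.trans h1⟩, h3⟩
      · rintro ⟨⟨h1, h2⟩, h3⟩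
        exact ⟨⟨h3.symm.trans h2, fun t ht hot => h1 t ⟨ht.1, ht.2⟩ (h3.trans hot)⟩, h3⟩
    set Pset : Set (BondConfig V) := (openConn o a ∩ ⋂ t ∈ T.filter (fun t => r t < r a), (openConn o t)ᶜ : Set (BondConfig V))
      with hPset
    have hdisj : Disjoint (Pset ∩ Ovoᶜ) (Pset ∩ Ovo) := by
      rw [Set.disjoint_left]
      rintro ω ⟨_, h1⟩ ⟨_, h2⟩
      exact h1 h2
    have hunion : (Pset ∩ Ovoᶜ) ∪ (Pset ∩ Ovo) = Pset := by
      rw [← inter_union_distrib_left, compl_union_self, inter_univ]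
    rw [← hcap, ← measureReal_union hdisj (hmeas _), hunion]
  -- (1) vdBHK Thm 1.3 given `D`: `1{o ∈ C_v}` and `1{a ∈ C_v}` are positively correlated
  have hFo : ∀ ω : BondConfig V, connIndicatorFn v o (openEdgeCluster ω v) = Ovo.indicator (1 : BondConfig V → ℝ) ω :=
    fun ω => connIndicatorFn_openEdgeCluster ω v o
  have hFa : ∀ ω : BondConfig V, connIndicatorFn v a (openEdgeCluster ω v) = Ova.indicator (1 : BondConfig V → ℝ) ω :=
    fun ω => connIndicatorFn_openEdgeCluster ω v a
  have h1 : μ.real (D ∩ Ovo) * μ.real (D ∩ Ova) ≤ μ.real D * μ.real (D ∩ (Ovo ∩ Ova)) := by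
    have key := BHK2006_clusterConditionalPositiveAssociation_holds V w v X (connIndicatorFn v o) (connIndicatorFn v a)
      (monotone_connIndicatorFn v o) (monotone_connIndicatorFn v a) hvX
    simp_rw [hFo, hFa, indicator_one_mul_indicator_one] at key
    rw [KNPreFKG.setIntegral_indicator_one_eq μ D Ovo, KNPreFKG.setIntegral_indicator_one_eq μ D Ova,
      KNPreFKG.setIntegral_indicator_one_eq μ D (Ovo ∩ Ova)] at key
    exact key
  -- (2) the antitone form: `1{o ∈ C_v}` and `1{C_v ∩ T_{≥a} = ∅}` are negatively correlated given `D`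
  set G : Set (Sym2 V) → ℝ := fun C => if (∀ t ∈ T, r a ≤ r t → ¬ (t = v ∨ ∃ e ∈ C, t ∈ e)) then 1 else 0 with hGdef
  have hG : Antitone G := by
    intro C C' hCC'
    simp only [hGdef]
    by_cases h : ∀ t ∈ T, r a ≤ r t → ¬ (t = v ∨ ∃ e ∈ C', t ∈ e)
    · have h' : ∀ t ∈ T, r a ≤ r t → ¬ (t = v ∨ ∃ e ∈ C, t ∈ e) := fun t ht hle hh =>
        h t ht hle (hh.imp id fun ⟨e, he, hte⟩ => ⟨e, hCC' he, hte⟩)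
      rw [if_pos h, if_pos h']
    · rw [if_neg h]
      split_ifs <;> norm_num
  have hGω : ∀ ω : BondConfig V, G (openEdgeCluster ω v) = Sav.indicator (1 : BondConfig V → ℝ) ω := by
    intro ω
    have hiff : (∀ t ∈ T, r a ≤ r t → ¬ (t = v ∨ ∃ e ∈ openEdgeCluster ω v, t ∈ e)) ↔ ω ∈ Sav := by
      simp only [hSav, mem_setOf_eq]
      refine forall_congr' fun t => forall_congr' fun _ => forall_congr' fun _ => ?_
      rw [reachable_iff_exists_mem_openEdgeCluster ω v t]
    simp only [hGdef]
    by_cases h : ω ∈ Sav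
    · rw [if_pos (hiff.2 h), indicator_of_mem h, Pi.one_apply]
    · rw [if_neg (fun h' => h (hiff.1 h')), indicator_of_notMem h]
  have h2 : μ.real D * μ.real (D ∩ (Ovo ∩ Sav)) ≤ μ.real (D ∩ Ovo) * μ.real (D ∩ Sav) := by
    have key := BHK2006_clusterConditionalPositiveAssociation.antitone_right BHK2006_clusterConditionalPositiveAssociation_holds
      V w v X (connIndicatorFn v o) G (monotone_connIndicatorFn v o) hG hvX
    simp_rw [hFo, hGω, indicator_one_mul_indicator_one] at key
    rw [KNPreFKG.setIntegral_indicator_one_eq μ D Ovo, KNPreFKG.setIntegral_indicator_one_eq μ D Sav,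
      KNPreFKG.setIntegral_indicator_one_eq μ D (Ovo ∩ Sav)] at key
    exact key
  -- the chain
  rw [hT, hOov, hPv, hsplit, mul_add]
  have hs1 : D ∩ (Ovo ∩ Ova) = D ∩ Ova ∩ Ovo := by
    ext ω; simp only [mem_inter_iff]; tauto
  have hs2 : D ∩ Sav ∩ Ovo = D ∩ (Ovo ∩ Sav) := by
    ext ω; simp only [mem_inter_iff]; tauto
  rw [hs1] at h1
  rw [hs2]
  suffices hmain : μ.real (D ∩ (Ovo ∩ Sav)) * μ.real (D ∩ Ova) ≤ μ.real (D ∩ Sav) * μ.real (D ∩ Ova ∩ Ovo) by linarith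
  rcases (hn D).lt_or_eq with hDpos | hD0
  · -- `μ(D) > 0`: chain (1) and (2) and cancel `μ(D)`
    have step : μ.real D * (μ.real (D ∩ (Ovo ∩ Sav)) * μ.real (D ∩ Ova)) ≤ μ.real D * (μ.real (D ∩ Sav) * μ.real (D ∩ Ova ∩ Ovo)) := by
      calc μ.real D * (μ.real (D ∩ (Ovo ∩ Sav)) * μ.real (D ∩ Ova))
          = (μ.real D * μ.real (D ∩ (Ovo ∩ Sav))) * μ.real (D ∩ Ova) := by ring
        _ ≤ (μ.real (D ∩ Ovo) * μ.real (D ∩ Sav)) * μ.real (D ∩ Ova) := by gcongr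
        _ = μ.real (D ∩ Sav) * (μ.real (D ∩ Ovo) * μ.real (D ∩ Ova)) := by ring
        _ ≤ μ.real (D ∩ Sav) * (μ.real D * μ.real (D ∩ Ova ∩ Ovo)) := by gcongr
        _ = μ.real D * (μ.real (D ∩ Sav) * μ.real (D ∩ Ova ∩ Ovo)) := by ring
    exact le_of_mul_le_mul_left step hDpos
  · -- `μ(D) = 0`: every event inside `D` is null
    have hz : ∀ S : Set (BondConfig V), μ.real (D ∩ S) = 0 := fun S =>
      le_antisymm (hD0 ▸ measureReal_mono inter_subset_left) (hn _)
    rw [hz, zero_mul]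
    exact mul_nonneg (hn _) (hn _)

/-- **Strict pattern transfer from the floor.**  If `μ(v ↮ T) > 0` and `μ(P^o_a ∩ {o ↮ v}) > 0` then
`μ({v ↮ T} ∩ {o ↔ v})·μ(P^v_a) < μ(v ↮ T)·μ(P^o_a)`. [cite: VandenbergHaggstromKahn2005, Thm. 1.3 (p. 6)] [cite: KozmaNitzan2024, Conj. 4 (p. 32)] -/
theorem pattern_transfer_strict_of_pos (w : Sym2 V → unitInterval) (T : Finset V) (r : V → ℕ) (a o v : V) (hvT : v ∉ T)
    (hD : 0 < (prodBernoulli w).real {ω : BondConfig V | ∀ t ∈ T, ¬ (openGraph ω).Reachable v t})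
    (hP : 0 < (prodBernoulli w).real ((openConn o a ∩ ⋂ t ∈ T.filter (fun t => r t < r a), (openConn o t)ᶜ : Set (BondConfig V)) ∩
            (openConn o v)ᶜ)) :
    (prodBernoulli w).real ({ω : BondConfig V | ∀ t ∈ T, ¬ (openGraph ω).Reachable v t} ∩ openConn o v) *
        (prodBernoulli w).real (openConn v a ∩ ⋂ t ∈ T.filter (fun t => r t < r a), (openConn v t)ᶜ : Set (BondConfig V)) <
      (prodBernoulli w).real {ω : BondConfig V | ∀ t ∈ T, ¬ (openGraph ω).Reachable v t} *
        (prodBernoulli w).real (openConn o a ∩ ⋂ t ∈ T.filter (fun t => r t < r a), (openConn o t)ᶜ : Set (BondConfig V)) := by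
  have h := pattern_transfer_floor w T r a o v hvT
  have hprod := mul_pos hD hP
  linarith

end CSH

end Summit.CriticalPhenomena.PercolationContinuityZ3.Theorems

end
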